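import Summits.QuantumFields.YangMills.Theorems.BalabanUVNodesPortHRecordJoinToDoor
import Summits.QuantumFields.YangMills.Theorems.BalabanUVNodesK0V23Stub3CofinalRunDoorAx

/-!
# PORT helper (PT-H ∕ K0ᴬ JOIN lineage `ymgap-nodeO-port-PTC-1`, g3) — K0ᴬ BY NAME FROM THE TWO SIGNED PORT TEXTS: `Theses.BalabanUVNodes.Record13SepCoPHInhabitedAx` ⟸
# ⁸ (`∀ F, Sig8LR4 F`, stmt-QuantumFields-27930) ∧ ⁷ (`∀ F, Sig7With Tok F`; at the SIGNED v11-G₄ text `Sig7V11G4`, stmt-QuantumFields-27931) ∧ the texts' antecedents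
# supplied cofinally in `Mc` (`JoinAntecedentsCofinal`) ∧ the (1.21)-Ax letter (run form on levels `≤ ½`, or window-`½` form) — the decay road's terminus composed

This module is the route-file-dependent companion of ✓`…PortHRecordJoinToDoor` (which stays outside the route's import cone, gate lint `theses-cone`): it composes that file's
★★ `decayLetter_of_texts` (lens-1's T′ per family, level `min γ₀ ½`) with ★ P3 g87's ∕ dag-n20-d's cofinal door ✓`K0V23Stub3CofinalRunDoorAx.record13SepCoPHInhabitedAx_of_
recordPlimDecayOnRunsAx_allRadii` (stub 1ᴮ PROVED, stub 2′ green, seam `rfl` inside).  Three theorems, no def.  Porter PTC-1 g3; `--supports stmt-QuantumFields-27238 --as helper`;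
no `--workitem` (R615).  The route file is imported (transitively) ONLY because the conclusion IS the crux decl by name; no port-row decl body is unfolded (docket O-8).
WHAT K0ᴬ OWES ON THE DECAY ROAD AFTER THIS FILE (exactly the displayed hypotheses of `record13SepCoPHInhabitedAx_of_textsG4_window`): the two OPEN port rows ⁸ (27930) and ⁷-G₄
(27931) as route decls (`∀ F, Sig8LR4 F` ∕ `∀ F, Sig7V11G4 F` are those decls by `Iff.rfl` today), `JoinAntecedentsCofinal (‴ ∧ TokRest4)` = Bałaban's theorems AT THE RECORD cofinally
in `Mc` (McGuard + guards + [15] Thm 1 + Gauge 9 + TokUk + TokP9-reg + ‴ + Tok-182 + Tok-cmpU-cap), and the (1.21)-Ax window-`½` letter (K3ᴬ ∕ (D4) currency).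
HONEST FRAMING.  CONDITIONAL helpers, NOT closers: every hypothesis is an OPEN signed text or a displayed Bałaban token or the (1.21)-Ax letter — none proved; typed ≠ proved;
K0ᴬ (stmt-QuantumFields-27238) stays OPEN; K-Ax 27239∕27247 OPEN; NODE O 0∕1; COUNT 8∕28 · K 1∕4 UNMOVED; ONE finite `𝕋⁴_{L^K}` at fixed ε — NOT continuum ∕ OS ∕ Clay;
**the Yang–Mills mass gap (Clay) is NOT proved by any of this.**  No `sorry` ∕ `instance` ∕ `notation`; standard axioms.  [I] = [Balaban1987RG1], [15] = [Balaban1985Variational].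
-/

noncomputable section

open scoped BigOperators Matrix.Norms.L2Operator Topology

namespace Summit.QuantumFields.YangMills.Theorems.PortHRecordJoin

open Summit.QuantumFields.YangMills.Theorems.K0RecordFormatNames
open Summit.QuantumFields.YangMills.Theorems
open Literature.MathematicalPhysics.QuantumFieldTheory.Balaban1983to89
open Literature.MathematicalPhysics.QuantumFieldTheory.Balaban1983to89.Node00
open Literature.MathematicalPhysics.QuantumFieldTheory.Balaban1983to89.T4Continuum (T4Family)
open Literature.MathematicalPhysics.QuantumFieldTheory.Balaban1983to89.T4OutputRate (Window)
open Literature.MathematicalPhysics.QuantumFieldTheory.Balaban1983to89.Node00.U3KernelLetters (PolLimitsExist)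

/-- ★★★ **K0ᴬ BY NAME FROM THE TWO TEXTS, FOR EVERY TOKEN**: ⁸ (`∀ F, Sig8LR4 F`) ∧ a ⁷-shaped text (`∀ F, Sig7With Tok F`) with `Tok ⟹ TokP9L4Old` ∧ cofinal antecedent witnesses ∧
the (1.21)-Ax run letter (levels `≤ ½`) ⟹ `Theses.BalabanUVNodes.Record13SepCoPHInhabitedAx` — through ✓`K0V23Stub3CofinalRunDoorAx.record13SepCoPHInhabitedAx_of_recordPlimDecayOnRunsAx_allRadii`
(★ P3's cofinal door; stub 1ᴮ PROVED, stub 2′ green, seam `rfl` inside).  A CONDITIONAL helper, NOT a closer: every hypothesis is an OPEN text or a displayed Bałaban token; K0ᴬ OPEN;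
**the Yang–Mills mass gap is NOT proved.** [cite: Balaban1987RG1, Thm 1 p.259, Thm 3 p.264, (1.19)–(1.22) pp.263–264, (5.10) p.293, (5.42) p.297; Balaban1985Variational, Thm 1 (8)–(9) p.279, Prop. 9 p.309; Balaban1988Convergent, Thm 1 p.262] -/
theorem record13SepCoPHInhabitedAx_of_texts (Tok : T4Family → ℕ → ℝ → Prop)
    (hBr : ∀ (F : T4Family) (Mc : ℕ) (a₀ : ℝ), Tok F Mc a₀ → TokP9L4Old F Mc a₀)
    (h8 : ∀ F, Sig8LR4 F) (h7 : ∀ F, Sig7With Tok F) (hA : ∀ F, JoinAntecedentsCofinal Tok F)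
    (h121 : ∀ (F : T4Family) (a₀ ε₂₉ γ : ℝ), 0 < a₀ → 0 < ε₂₉ → 0 < γ → γ ≤ 1 / 2 → RecordPolLimitOnRunsAx F a₀ ε₂₉ γ) :
    Summit.QuantumFields.YangMills.Theses.BalabanUVNodes.Record13SepCoPHInhabitedAx :=
  K0V23Stub3CofinalRunDoorAx.record13SepCoPHInhabitedAx_of_recordPlimDecayOnRunsAx_allRadii
    fun F a₀ ha₀ => decayLetter_of_texts Tok hBr F (h8 F) (h7 F) (hA F) (h121 F) a₀ ha₀

/-- ★★★ **THE INSTANCE AT THE SIGNED v11-G₄ TEXT of stmt-QuantumFields-27931** (`Sig7V11G4`, bca3cb0d9af367ce; token `TokP9L4‴ ∧ TokRest4`, bridge ★ PTB-1 ✓p802240 on the first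
conjunct): ⁸ ∧ ⁷-G₄ ∧ cofinal antecedent witnesses ∧ the (1.21)-Ax run letter ⟹ K0ᴬ BY NAME.  CONDITIONAL helper; K0ᴬ OPEN; nothing of Bałaban discharged.
[cite: Balaban1987RG1, Thm 1 p.259, Thm 3 p.264, (5.10) p.293; Balaban1985Variational, Prop. 9 p.309, (182) p.307, (190) p.308] -/
theorem record13SepCoPHInhabitedAx_of_textsG4
    (h8 : ∀ F, Sig8LR4 F) (h7 : ∀ F, Sig7V11G4 F)
    (hA : ∀ F, JoinAntecedentsCofinal (fun F Mc a₀ => TokP9L4New F Mc a₀ ∧ TokRest4 F Mc a₀) F)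
    (h121 : ∀ (F : T4Family) (a₀ ε₂₉ γ : ℝ), 0 < a₀ → 0 < ε₂₉ → 0 < γ → γ ≤ 1 / 2 → RecordPolLimitOnRunsAx F a₀ ε₂₉ γ) :
    Summit.QuantumFields.YangMills.Theses.BalabanUVNodes.Record13SepCoPHInhabitedAx :=
  record13SepCoPHInhabitedAx_of_texts _ (fun F Mc a₀ h => tokP9L4Old_of_new F Mc a₀ h.1) h8
    (fun F => sig7With_of_sig7V11G4 F (h7 F)) hA h121

/-- ★★★ **THE G₄ INSTANCE WITH THE (1.21)-Ax LETTER IN WINDOW FORM** (`PolLimitsExist … (Window ½)` per `(F, a₀, ε₂₉)` — the (D4)∕K3ᴬ currency).  CONDITIONAL helper; K0ᴬ OPEN.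
[cite: Balaban1987RG1, Thm 1 p.259, Thm 3 p.264, (1.21) p.264, (5.10) p.293; Balaban1985Variational, Prop. 9 p.309] -/
theorem record13SepCoPHInhabitedAx_of_textsG4_window
    (h8 : ∀ F, Sig8LR4 F) (h7 : ∀ F, Sig7V11G4 F)
    (hA : ∀ F, JoinAntecedentsCofinal (fun F Mc a₀ => TokP9L4New F Mc a₀ ∧ TokRest4 F Mc a₀) F)
    (hW : ∀ (F : T4Family) (a₀ ε₂₉ : ℝ), 0 < a₀ → 0 < ε₂₉ →
      letI θ := thetaFill F a₀ ε₂₉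
      letI := θ.instVβ₁; letI := θ.instVβ₂; letI := θ.instιβ
      PolLimitsExist F (recordTermsAx F a₀ ε₂₉) θ.ρ8 θ.bV (Window (1 / 2))) :
    Summit.QuantumFields.YangMills.Theses.BalabanUVNodes.Record13SepCoPHInhabitedAx :=
  record13SepCoPHInhabitedAx_of_textsG4 h8 h7 hA fun F => run121_of_window121 F (hW F)

/-! ## (appended 2026-08-31, ◇ lens-1 g6 SCOPE FLAG ∕ docket O-11) K0ᴬ BY NAME WITHOUT the K3-side `h121`: the (1.21) proviso discharged IN SCOPE by `JoinConclLimR` -/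

/-- ★★★ **K0ᴬ BY NAME FROM THE COFINAL ANTECEDENTS AND THE IN-SCOPE LIMIT+DECAY CONSEQUENT** (no `h121`, no window letter): `∀ F, JoinAntecedentsCofinal Tok F` ∧ `∀ F, JoinConclLimR Tok F`
(O-11's limit twin supplies the latter from the two texts) ⟹ `Theses.BalabanUVNodes.Record13SepCoPHInhabitedAx`, via ✓`decayLetter_of_lim` and ★ P3's cofinal door.  CONDITIONAL helper;
K0ᴬ OPEN; nothing of Bałaban discharged; **the Yang–Mills mass gap is NOT proved.** [cite: Balaban1987RG1, Thm 1 p.259, Thm 3 p.264, (1.21)–(1.22) p.264, (5.10) p.293, (5.42) p.297; Balaban1985Variational, Thm 1 (8)–(9) p.279; Balaban1988Convergent, Thm 1 p.262] -/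
theorem record13SepCoPHInhabitedAx_of_lim (Tok : T4Family → ℕ → ℝ → Prop)
    (hA : ∀ F, JoinAntecedentsCofinal Tok F) (hL : ∀ F, JoinConclLimR Tok F) :
    Summit.QuantumFields.YangMills.Theses.BalabanUVNodes.Record13SepCoPHInhabitedAx :=
  K0V23Stub3CofinalRunDoorAx.record13SepCoPHInhabitedAx_of_recordPlimDecayOnRunsAx_allRadii
    fun F a₀ ha₀ => decayLetter_of_lim (hA F) (hL F) a₀ ha₀

end Summit.QuantumFields.YangMills.Theorems.PortHRecordJoin

end
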